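import Literature.NumberTheory.IwasawaTheory.CyclotomicTwoTowerOddPrimeDecomposition
import Literature.NumberTheory.EllipticCurves.CyclotomicZpExtensionLayerGeneratorProofs
import Literature.NumberTheory.NumberFields.CyclotomicTwoTowerLayerPolynomials
import Mathlib.NumberTheory.NumberField.Cyclotomic.Basic
import Mathlib.NumberTheory.RamificationInertia.Inertia
import Mathlib.RingTheory.Polynomial.Cyclotomic.Roots
import Mathlib.FieldTheory.Finite.Basic
import HarnessLib

/-!
# The splitting law of an odd prime in the layers `ℚ_n = ℚ(ζ_{2^{n+2}})⁺` of the cyclotomic `ℤ₂`-tower: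
# `ℓ` splits completely in `ℚ_n` ⟺ `ℓ ≡ ±1 (mod 2^{n+2})` (residue-field Frobenius; proved, no definition, no named fact)

Topic `NumberTheory/IwasawaTheory` (namespace = path).  THEOREM-ONLY file, written by the prover seat `bsd-line-att-p3` g30 (cell `bsd-f1-sign2`;
`--supports` stmt-BirchSwinnertonDyer-22298; closes nothing).  Sequel of `CyclotomicTwoTowerOddPrimeDecomposition.lean` (there: one prime above `ℓ` in
`ℚ_n`, `n ≥ 1`, iff `ℓ ≡ ±3 (mod 8)`).  Here the other end of the scale — complete splitting — by a residue-field computation in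
`ℤ[ζ]/𝔔` (no Dedekind–Kummer, no Frobenius ELEMENT): with `ζ` a primitive `2^{n+2}`-th root of unity, `C = ℚ(ζ)`, `𝓞_C = ℤ[ζ]` (Mathlib), `θ = ζ + ζ⁻¹`,
`ℚ_n = ℚ(θ)`, `𝔔 ∣ w ∣ ℓ` primes of `C ⊇ ℚ_n ⊇ ℚ`, `ζ̄` the image of `ζ` in the finite field `𝓞_C/𝔔` (a primitive `2^{n+2}`-th root of unity there):

* (⟸) if `ℓ ≡ ±1 (mod 2^{n+2})` then `ζ̄^ℓ = ζ̄^{±1}`, and every `x ∈ 𝓞_{ℚ_n}` is `P(ζ)` with `P ∈ ℤ[X]` and `P(ζ⁻¹) = P(ζ)` (apply the automorphism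
  `ζ ↦ ζ⁻¹` of `ℚ̄`, which fixes `ℚ(θ)`), so `x̄^ℓ = P(ζ̄^ℓ) = P(ζ̄^{±1}) = x̄`: the residue field `𝓞_{ℚ_n}/w ↪ 𝓞_C/𝔔` is killed by `y ↦ y^ℓ − y`, hence has
  `ℓ` elements: `f(w ∣ ℓ) = 1`;
* (⟹) if `f(w ∣ ℓ) = 1` then `θ̄^ℓ = θ̄`, i.e. `ζ̄^ℓ + ζ̄^{−ℓ} = ζ̄ + ζ̄⁻¹`, i.e. `(ζ̄^ℓ − ζ̄)(ζ̄^{ℓ+1} − 1) = 0`, so `2^{n+2} ∣ ℓ ∓ 1`.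

Main results (`κ` any cyclotomic `ℤ₂`-extension of `ℚ`, `ℓ` an odd prime, `g_n(ℓ)` the number of primes of `ℚ_n` above `ℓ`):
* §1 `card_le_of_forall_pow_eq` (a finite field on which `y ↦ y^ℓ` is the identity has `≤ ℓ` elements); §2 `natCard_quotient_eq_pow_inertiaDeg`,
  `inertiaDeg_eq_one_iff_forall_pow_eq` (residue degree one ⟺ `y^ℓ = y` on the residue field).
* §3 `exists_algEquiv_apply_eq_inv` (an automorphism of `ℚ̄` with `ζ ↦ ζ⁻¹`), `apply_eq_self_of_mem_adjoin_simple` (an automorphism fixing `α` fixes `F⟮α⟯`; so `ζ ↦ ζ⁻¹` fixes `ℚ(ζ + ζ⁻¹)`),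
  `layer_eq_adjoin_add_inv` (**`ℚ_n = ℚ(ζ + ζ⁻¹)`** as subfields of `ℚ̄`).
* §4 ★ **`inertiaDeg_eq_one_iff_of_liesOver_layer`** — for a prime `w ∣ ℓ` of `ℚ_n`: `f(w ∣ ℓ) = 1 ⟺ ℓ ≡ ±1 (mod 2^{n+2})`;
  ★ **`ncard_primesOver_layer_eq_two_pow_iff`** — **`g_n(ℓ) = 2ⁿ ⟺ ℓ ≡ ±1 (mod 2^{n+2})`**.

HONEST SCOPE: textbook (Washington Thm. 2.13 / Prop. 2.16: `ℓ` splits completely in `ℚ(ζ_m)⁺` iff `ℓ ≡ ±1 (mod m)`); nothing here is specific to any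
summit; BSD is not proved by any of this.

## References
* L. C. Washington, *Introduction to Cyclotomic Fields*, 2nd ed. (1997), Thm. 2.13, Prop. 2.16, §13.1. [Washington1997]
* D. A. Marcus, *Number Fields*, 2nd ed. (2018), Ch. 2 (ex. 35: `ℤ[ζ + ζ⁻¹]`), Ch. 4 Thm. 26. [Marcus2018]
-/

set_option autoImplicit false

noncomputable section

open scoped NumberField Polynomial
open NumberField IsDedekindDomain Field IntermediateField Module Ideal Polynomial

namespace Literature.NumberTheory.IwasawaTheory

open Literature.NumberTheory.EllipticCurves Literature.NumberTheory.EllipticCurves.ZpExtension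
  Literature.NumberTheory.GaloisRepresentations Literature.NumberTheory.NumberFields

/-! ## §1 A finite field killed by `y ↦ y^ℓ − y` has at most `ℓ` elements -/

/-- If every element of a finite field `F` satisfies `y^ℓ = y` (`ℓ ≥ 2`), then `#F ≤ ℓ` (all elements are roots of `X^ℓ − X`).
[cite: Washington1997, Thm. 2.13 (proof: residue fields)] -/
theorem card_le_of_forall_pow_eq {F : Type*} [Field F] [Fintype F] {ℓ : ℕ} (hℓ : 2 ≤ ℓ) (h : ∀ y : F, y ^ ℓ = y) :
    Fintype.card F ≤ ℓ := by
  classical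
  set P : F[X] := X ^ ℓ - X with hP
  have hdeg : P.natDegree = ℓ := by
    rw [hP]
    exact FiniteField.X_pow_card_sub_X_natDegree_eq F (by omega)
  have hP0 : P ≠ 0 := by
    intro h0
    have := congrArg natDegree h0
    rw [hdeg, natDegree_zero] at this
    omega
  have hroots : ∀ y : F, y ∈ P.roots := fun y => by
    rw [mem_roots hP0, IsRoot, hP, eval_sub, eval_pow, eval_X, h y, sub_self]
  calc Fintype.card F = (Finset.univ : Finset F).card := Finset.card_univ.symm
    _ ≤ P.roots.toFinset.card := Finset.card_le_card fun y _ => Multiset.mem_toFinset.mpr (hroots y)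
    _ ≤ Multiset.card P.roots := Multiset.toFinset_card_le _
    _ ≤ P.natDegree := card_roots' P
    _ = ℓ := hdeg


/-! ## §2 Residue degree one ⟺ the residue field is killed by `y ↦ y^ℓ − y` -/

section Residue

variable {K : Type*} [Field K] [NumberField K] {ℓ : ℕ}

/-- **`#(𝓞_K/w) = ℓ^{f(w∣ℓ)}`** for a prime `w` of a number field `K` above `ℓ` (Mathlib's `absNorm P = ℓ^f` rewritten with the new
`Ideal.inertiaDeg`). [cite: NeukirchANT1999, Ch. I §8 (8.2)] -/
theorem natCard_quotient_eq_pow_inertiaDeg (hℓ : ℓ.Prime) (w : Ideal (𝓞 K)) [w.IsMaximal] [w.LiesOver (Ideal.span {(ℓ : ℤ)})] :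
    Nat.card (𝓞 K ⧸ w) = ℓ ^ w.inertiaDeg ℤ := by
  haveI : Fact ℓ.Prime := ⟨hℓ⟩
  haveI : (Ideal.span {(ℓ : ℤ)}).IsMaximal := Int.ideal_span_isMaximal_of_prime ℓ
  rw [← Submodule.cardQuot_apply, ← Ideal.absNorm_apply, Ideal.absNorm_eq_pow_inertiaDeg' w hℓ,
    Ideal.inertiaDeg'_eq_inertiaDeg (Ideal.span {(ℓ : ℤ)}) w]

/-- **`f(w∣ℓ) = 1 ⟺ y^ℓ = y` for every `y ∈ 𝓞_K/w`** (`w` a prime of the number field `K` above the prime `ℓ`).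
[cite: Washington1997, Thm. 2.13 (proof: residue fields)] -/
theorem inertiaDeg_eq_one_iff_forall_pow_eq (hℓ : ℓ.Prime) (w : Ideal (𝓞 K)) [w.IsMaximal] [w.LiesOver (Ideal.span {(ℓ : ℤ)})] :
    w.inertiaDeg ℤ = 1 ↔ ∀ y : 𝓞 K ⧸ w, y ^ ℓ = y := by
  classical
  haveI : Fact ℓ.Prime := ⟨hℓ⟩
  have hℓ0 : (Ideal.span {(ℓ : ℤ)}) ≠ ⊥ := by
    rw [Ne, Ideal.span_singleton_eq_bot]; exact_mod_cast hℓ.ne_zero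
  have hw0 : w ≠ ⊥ := Ideal.ne_bot_of_liesOver_of_ne_bot hℓ0 w
  haveI : Finite (𝓞 K ⧸ w) := Ideal.finiteQuotientOfFreeOfNeBot w hw0
  letI : Fintype (𝓞 K ⧸ w) := Fintype.ofFinite _
  letI : Field (𝓞 K ⧸ w) := Ideal.Quotient.field w
  have hcard := natCard_quotient_eq_pow_inertiaDeg hℓ w
  rw [Nat.card_eq_fintype_card] at hcard
  constructor
  · intro h1 y
    rw [h1, pow_one] at hcard
    have := FiniteField.pow_card y
    rwa [hcard] at this
  · intro h
    have hle := card_le_of_forall_pow_eq hℓ.two_le h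
    rw [hcard] at hle
    have hpos : 0 < w.inertiaDeg ℤ := w.inertiaDeg_pos ℤ
    by_contra hne
    have h2 : 2 ≤ w.inertiaDeg ℤ := by omega
    have : ℓ ^ 2 ≤ ℓ ^ w.inertiaDeg ℤ := Nat.pow_le_pow_right hℓ.pos h2
    nlinarith [hℓ.two_le]

end Residue

/-! ## §3 The automorphism `ζ ↦ ζ⁻¹` of `ℚ̄` fixes `ℚ(ζ + ζ⁻¹) = ℚ_n` -/

section Conj

/-- **An automorphism with `ζ ↦ ζ⁻¹`** of a normal extension `L/ℚ` containing a primitive `m`-th root of unity `ζ` (`ζ` and `ζ⁻¹` have the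
same minimal polynomial over `ℚ`, the `m`-th cyclotomic polynomial). [cite: Washington1997, Thm. 2.5 (Gal(ℚ(ζ_m)/ℚ) ≅ (ℤ/m)ˣ)] -/
theorem exists_algEquiv_apply_eq_inv {L : Type*} [Field L] [CharZero L] [Algebra ℚ L] [Normal ℚ L] {m : ℕ} (hm : 0 < m) {ζ : L}
    (hζ : IsPrimitiveRoot ζ m) : ∃ σ : L ≃ₐ[ℚ] L, σ ζ = ζ⁻¹ := by
  have hq : (DivisionRing.toRatAlgebra : Algebra ℚ L) = ‹Algebra ℚ L› := Subsingleton.elim _ _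
  have h1 := (cyclotomic_eq_minpoly_rat hζ hm).symm
  have h2 := (cyclotomic_eq_minpoly_rat hζ.inv hm).symm
  rw [hq] at h1 h2
  obtain ⟨σ, hσ⟩ := (Normal.minpoly_eq_iff_mem_orbit (F := ℚ) (E := L)).mp (h2.trans h1.symm)
  exact ⟨σ, hσ⟩

/-- An automorphism fixing `α` fixes `F⟮α⟯` pointwise. [cite: Washington1997, §2 (Galois theory of ℚ(ζ))] -/
theorem apply_eq_self_of_mem_adjoin_simple {F L : Type*} [Field F] [Field L] [Algebra F L] (σ : L ≃ₐ[F] L) {α : L}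
    (hα : σ α = α) {x : L} (hx : x ∈ F⟮α⟯) : σ x = x := by
  have hstab : Subgroup.zpowers σ ≤ MulAction.stabilizer (L ≃ₐ[F] L) α := Subgroup.zpowers_le.mpr hα
  have hle : F⟮α⟯ ≤ IntermediateField.fixedField (Subgroup.zpowers σ) := by
    rw [IntermediateField.adjoin_simple_le_iff, IntermediateField.mem_fixedField_iff]
    intro f hf
    exact hstab hf
  have hx' := hle hx
  rw [IntermediateField.mem_fixedField_iff] at hx'
  exact hx' σ (Subgroup.mem_zpowers σ)

variable {κ : ZpExtension ℚ 2}

/-- **`ℚ_n = ℚ(ζ + ζ⁻¹)`** inside `ℚ̄`, for every cyclotomic `ℤ₂`-extension `κ` of `ℚ` and every primitive `2^{n+2}`-th root of unity `ζ`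
(`ζ + ζ⁻¹ ∈ ℚ_n`, tree `IsCyclotomic.add_inv_mem_layer`; both fields have degree `2ⁿ`, tree `NestedSqrtTwo.finrank_rat_adjoin_eq`).
[cite: Washington1997, §13.1 (`ℚ_n = ℚ(ζ_{2^{n+2}})⁺`)] -/
theorem layer_eq_adjoin_add_inv (hκ : κ.IsCyclotomic) (n : ℕ) {ζ : AlgebraicClosure ℚ} (hζ : IsPrimitiveRoot ζ (2 ^ (n + 2))) :
    κ.layer n = ℚ⟮ζ + ζ⁻¹⟯ := by
  haveI : FiniteDimensional ℚ ↥(κ.layer n) := κ.finiteDimensional_layer_holds n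
  have hle : ℚ⟮ζ + ζ⁻¹⟯ ≤ κ.layer n := IntermediateField.adjoin_simple_le_iff.mpr (IsCyclotomic.add_inv_mem_layer hκ n hζ)
  have hθ : (fun x : AlgebraicClosure ℚ => x ^ 2 - 2)^[n] (ζ + ζ⁻¹) = 0 := NestedSqrtTwo.iterate_add_inv_eq_zero hζ
  have hfin : Module.finrank ℚ ↥ℚ⟮ζ + ζ⁻¹⟯ = 2 ^ n := NestedSqrtTwo.finrank_rat_adjoin_eq hθ
  exact (IntermediateField.eq_of_le_of_finrank_eq hle (hfin.trans (κ.finrank_layer_holds n).symm)).symm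

end Conj

/-! ## §4 The splitting law: `f(w ∣ ℓ) = 1 ⟺ ℓ ≡ ±1 (mod 2^{n+2})`, `g_n(ℓ) = 2ⁿ ⟺ ℓ ≡ ±1 (mod 2^{n+2})` -/

section Split

variable {κ : ZpExtension ℚ 2} (hκ : κ.IsCyclotomic) (n : ℕ)

/-- In a field, `a + a⁻¹ = b + b⁻¹` with `a, b ≠ 0` forces `b = a` or `a * b = 1`. [cite: Washington1997, Prop. 2.16 (proof)] -/
private theorem eq_or_mul_eq_one_of_add_inv_eq {R : Type*} [Field R] {a b : R} (ha : a ≠ 0) (hb : b ≠ 0)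
    (h : b + b⁻¹ = a + a⁻¹) : b = a ∨ a * b = 1 := by
  have key : (a - b) * (a * b - 1) = 0 := by
    have h' : (b + b⁻¹) * (a * b) = (a + a⁻¹) * (a * b) := by rw [h]
    have e1 : (b + b⁻¹) * (a * b) = a * b ^ 2 + a := by field_simp
    have e2 : (a + a⁻¹) * (a * b) = a ^ 2 * b + b := by field_simp
    rw [e1, e2] at h'
    linear_combination -h'
  rcases mul_eq_zero.mp key with h0 | h0
  · left; exact (sub_eq_zero.mp h0).symm
  · right; exact sub_eq_zero.mp h0

include hκ in
/-- ★ **The splitting law in `ℚ_n`: for a prime `w` of `ℚ_n` above the odd prime `ℓ`, `f(w ∣ ℓ) = 1 ⟺ ℓ ≡ ±1 (mod 2^{n+2})`.**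
With `ζ` a primitive `2^{n+2}`-th root of unity, `C = ℚ(ζ) ⊇ ℚ_n = ℚ(ζ + ζ⁻¹)`, `𝔔 ∣ w` in `𝓞_C = ℤ[ζ]`, `ζ̄ ∈ 𝓞_C/𝔔` a primitive `2^{n+2}`-th root:
(⟸) `ζ̄^ℓ = ζ̄^{±1}` and every `x ∈ 𝓞_{ℚ_n}` is `P(ζ)` with `P(ζ⁻¹) = P(ζ)`, so `x̄^ℓ = x̄` and `𝓞_{ℚ_n}/w` has `ℓ` elements; (⟹) `θ̄^ℓ = θ̄` for
`θ = ζ + ζ⁻¹` gives `(ζ̄^ℓ − ζ̄)(ζ̄^{ℓ+1} − 1) = 0`. [cite: Washington1997, Thm. 2.13 and Prop. 2.16] [cite: Marcus2018, Ch. 4 Thm. 26] -/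
theorem inertiaDeg_eq_one_iff_of_liesOver_layer {ℓ : ℕ} (hℓ : ℓ.Prime) (hℓ2 : ℓ ≠ 2) [NumberField ↥(κ.layer n)]
    (w : Ideal (𝓞 ↥(κ.layer n))) [w.IsMaximal] [w.LiesOver (Ideal.span {(ℓ : ℤ)})] :
    w.inertiaDeg ℤ = 1 ↔ (ℓ % 2 ^ (n + 2) = 1 ∨ ℓ % 2 ^ (n + 2) = 2 ^ (n + 2) - 1) := by
  classical
  haveI : Fact ℓ.Prime := ⟨hℓ⟩
  set m : ℕ := 2 ^ (n + 2) with hm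
  have hm4 : 4 ≤ m := by
    rw [hm, pow_succ, pow_succ]
    have : 1 ≤ 2 ^ n := Nat.one_le_two_pow
    omega
  have hmpos : 0 < m := by omega
  haveI : (Ideal.span {(ℓ : ℤ)}).IsMaximal := Int.ideal_span_isMaximal_of_prime ℓ
  -- the cyclotomic field `C = ℚ(ζ) ⊇ ℚ_n = ℚ(ζ + ζ⁻¹)`
  haveI : NeZero ((m : ℕ) : ℚ) := ⟨by positivity⟩
  obtain ⟨ζ, hζ⟩ := HasEnoughRootsOfUnity.exists_primitiveRoot (AlgebraicClosure ℚ) m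
  haveI : Algebra.IsAlgebraic ℚ (AlgebraicClosure ℚ) := AlgebraicClosure.isAlgebraic ℚ
  haveI hC : IsCyclotomicExtension {m} ℚ ↥ℚ⟮ζ⟯ := hζ.intermediateField_adjoin_isCyclotomicExtension ℚ
  haveI : FiniteDimensional ℚ ↥ℚ⟮ζ⟯ := IsCyclotomicExtension.finite {m} ℚ ↥ℚ⟮ζ⟯
  haveI : NumberField ↥ℚ⟮ζ⟯ := NumberField.of_module_finite ℚ _
  have hle : κ.layer n ≤ ℚ⟮ζ⟯ := layer_le_adjoin_of_isPrimitiveRoot hκ n hζ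
  letI : Algebra ↥(κ.layer n) ↥ℚ⟮ζ⟯ := (IntermediateField.inclusion hle).toRingHom.toAlgebra
  haveI : IsScalarTower ℚ ↥(κ.layer n) ↥ℚ⟮ζ⟯ := IsScalarTower.of_algebraMap_eq fun _ => rfl
  have hlayer : κ.layer n = ℚ⟮ζ + ζ⁻¹⟯ := layer_eq_adjoin_add_inv hκ n hζ
  -- `ζ` inside `C`, its integral power basis, the prime `𝔔 ∣ w`, the residue field `R = 𝓞_C/𝔔`
  set z : ↥ℚ⟮ζ⟯ := AdjoinSimple.gen ℚ ζ with hzdef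
  have hzval : (z : AlgebraicClosure ℚ) = ζ := AdjoinSimple.algebraMap_gen ℚ ζ
  have hz : IsPrimitiveRoot z m :=
    IsPrimitiveRoot.of_map_of_injective (f := algebraMap ↥ℚ⟮ζ⟯ (AlgebraicClosure ℚ)) (by rw [show algebraMap ↥ℚ⟮ζ⟯ _ z = ζ from hzval]; exact hζ)
      (algebraMap ↥ℚ⟮ζ⟯ (AlgebraicClosure ℚ)).injective
  set ζ' : 𝓞 ↥ℚ⟮ζ⟯ := hz.toInteger with hζ'def
  have hz' : IsPrimitiveRoot ζ' m := hz.toInteger_isPrimitiveRoot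
  have hζ'val : ((ζ' : ↥ℚ⟮ζ⟯) : AlgebraicClosure ℚ) = ζ := hzval
  have hw0 : w ≠ ⊥ := Ideal.ne_bot_of_liesOver_of_ne_bot
    (by rw [Ne, Ideal.span_singleton_eq_bot]; exact_mod_cast hℓ.ne_zero : (Ideal.span {(ℓ : ℤ)}) ≠ ⊥) w
  obtain ⟨⟨𝔔, h𝔔, h𝔔w⟩⟩ := w.nonempty_primesOver (S := 𝓞 ↥ℚ⟮ζ⟯)
  haveI := h𝔔
  haveI := h𝔔w
  haveI : 𝔔.IsMaximal := h𝔔.isMaximal (Ideal.ne_bot_of_liesOver_of_ne_bot hw0 𝔔)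
  haveI h𝔔ℓ : 𝔔.LiesOver (Ideal.span {(ℓ : ℤ)}) := Ideal.LiesOver.trans 𝔔 w (Ideal.span {(ℓ : ℤ)})
  letI : Field (𝓞 ↥ℚ⟮ζ⟯ ⧸ 𝔔) := Ideal.Quotient.field 𝔔
  set π := Ideal.Quotient.mk 𝔔 with hπ
  have hℓ0 : ((ℓ : ℕ) : 𝓞 ↥ℚ⟮ζ⟯ ⧸ 𝔔) = 0 := by
    have h1 : algebraMap ℤ (𝓞 ↥ℚ⟮ζ⟯) (ℓ : ℤ) ∈ 𝔔 :=
      (Ideal.mem_of_liesOver 𝔔 (Ideal.span {(ℓ : ℤ)}) (ℓ : ℤ)).mp (Ideal.mem_span_singleton_self _)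
    rw [map_natCast] at h1
    rw [← map_natCast π, hπ, Ideal.Quotient.eq_zero_iff_mem]
    exact h1
  haveI hchar : CharP (𝓞 ↥ℚ⟮ζ⟯ ⧸ 𝔔) ℓ := (CharP.charP_iff_prime_eq_zero hℓ).mpr hℓ0
  haveI : ExpChar (𝓞 ↥ℚ⟮ζ⟯ ⧸ 𝔔) ℓ := ExpChar.prime hℓ
  -- `ζ̄` is a primitive `m`-th root of unity in the residue field
  have h2R : (2 : 𝓞 ↥ℚ⟮ζ⟯ ⧸ 𝔔) ≠ 0 := by
    intro h
    have h' : ((2 : ℕ) : 𝓞 ↥ℚ⟮ζ⟯ ⧸ 𝔔) = 0 := by exact_mod_cast h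
    rw [CharP.cast_eq_zero_iff (𝓞 ↥ℚ⟮ζ⟯ ⧸ 𝔔) ℓ] at h'
    exact hℓ2 ((Nat.prime_dvd_prime_iff_eq hℓ Nat.prime_two).mp h')
  haveI : NeZero ((m : ℕ) : 𝓞 ↥ℚ⟮ζ⟯ ⧸ 𝔔) := ⟨by rw [hm]; push_cast; exact pow_ne_zero _ h2R⟩
  have hζbar : IsPrimitiveRoot (π ζ') m := by
    rw [← isRoot_cyclotomic_iff, ← map_cyclotomic m π, IsRoot.def, eval_map, eval₂_hom,
      (isRoot_cyclotomic_iff.mpr hz').eq_zero, map_zero]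
  -- every `x ∈ 𝓞 ℚ_n` is an integer polynomial in `ζ'`, fixed by `ζ ↦ ζ⁻¹`
  haveI : Normal ℚ (AlgebraicClosure ℚ) := by
    exact (inferInstance : @Normal ℚ (AlgebraicClosure ℚ) _ _ (AlgebraicClosure.instAlgebra ℚ))
  obtain ⟨σ, hσ⟩ := exists_algEquiv_apply_eq_inv (L := AlgebraicClosure ℚ) hmpos hζ
  have hσθ : σ (ζ + ζ⁻¹) = ζ + ζ⁻¹ := by rw [map_add, map_inv₀, hσ, inv_inv, add_comm]
  have hfix : ∀ x : ↥(κ.layer n), σ (x : AlgebraicClosure ℚ) = x := fun x =>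
    apply_eq_self_of_mem_adjoin_simple σ hσθ (hlayer ▸ x.2 : (x : AlgebraicClosure ℚ) ∈ ℚ⟮ζ + ζ⁻¹⟯)
  have hζinv : ζ ^ (m - 1) = ζ⁻¹ := by
    have h1 : ζ ^ (m - 1) * ζ = 1 := by rw [← pow_succ, Nat.sub_one_add_one_eq_of_pos hmpos, hζ.pow_eq_one]
    exact eq_inv_of_mul_eq_one_left h1
  -- the Frobenius identity `x̄^ℓ = π (P(ζ'^ℓ))` for `x = P(ζ')`
  have hfrob : ∀ (P : ℤ[X]) (a : 𝓞 ↥ℚ⟮ζ⟯), (π (aeval a P)) ^ ℓ = π (aeval (a ^ ℓ) P) := by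
    intro P a
    have e1 : π (aeval a P) = aeval (π a) P := (aeval_algHom_apply π.toIntAlgHom a P).symm
    have e2 : π (aeval (a ^ ℓ) P) = aeval (π (a ^ ℓ)) P := (aeval_algHom_apply π.toIntAlgHom (a ^ ℓ) P).symm
    have e3 : frobenius (𝓞 ↥ℚ⟮ζ⟯ ⧸ 𝔔) ℓ (aeval (π a) P) = aeval (frobenius (𝓞 ↥ℚ⟮ζ⟯ ⧸ 𝔔) ℓ (π a)) P :=
      (aeval_algHom_apply (frobenius (𝓞 ↥ℚ⟮ζ⟯ ⧸ 𝔔) ℓ).toIntAlgHom (π a) P).symm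
    rw [frobenius_def, frobenius_def] at e3
    rw [e1, e3, e2, map_pow]
  -- coercions `𝓞 C → C → ℚ̄` commute with `aeval`
  have hcoe : ∀ (P : ℤ[X]) (a : 𝓞 ↥ℚ⟮ζ⟯), (((aeval a P : 𝓞 ↥ℚ⟮ζ⟯) : ↥ℚ⟮ζ⟯) : AlgebraicClosure ℚ) =
      aeval (((a : ↥ℚ⟮ζ⟯) : AlgebraicClosure ℚ)) P := by
    intro P a
    rw [show ((aeval a P : 𝓞 ↥ℚ⟮ζ⟯) : ↥ℚ⟮ζ⟯) = aeval (a : ↥ℚ⟮ζ⟯) P from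
      (aeval_algHom_apply (algebraMap (𝓞 ↥ℚ⟮ζ⟯) ↥ℚ⟮ζ⟯).toIntAlgHom a P).symm]
    exact (aeval_algHom_apply (algebraMap ↥ℚ⟮ζ⟯ (AlgebraicClosure ℚ)).toIntAlgHom (a : ↥ℚ⟮ζ⟯) P).symm
  -- (⟸): if `ℓ ≡ ±1 (mod m)` then `x̄^ℓ = x̄` for every `x ∈ 𝓞 ℚ_n`
  have hback : (ℓ % m = 1 ∨ ℓ % m = m - 1) → ∀ y : 𝓞 ↥(κ.layer n) ⧸ w, y ^ ℓ = y := by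
    intro hcong y
    obtain ⟨x, rfl⟩ := Ideal.Quotient.mk_surjective y
    have hinj : Function.Injective (algebraMap (𝓞 ↥(κ.layer n) ⧸ w) (𝓞 ↥ℚ⟮ζ⟯ ⧸ 𝔔)) :=
      FaithfulSMul.algebraMap_injective _ _
    apply hinj
    rw [map_pow, Ideal.Quotient.algebraMap_mk_of_liesOver]
    set xC := algebraMap (𝓞 ↥(κ.layer n)) (𝓞 ↥ℚ⟮ζ⟯) x with hxC
    obtain ⟨P, hP⟩ := hz.integralPowerBasis.exists_eq_aeval' xC
    rw [IsPrimitiveRoot.integralPowerBasis_gen] at hP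
    change (π xC) ^ ℓ = π xC
    rw [hP, hfrob]
    -- `ζ'^ℓ = ζ'` or `ζ'^ℓ = ζ'^{m-1}`, and in the second case `P(ζ^{m-1}) = P(ζ⁻¹) = σ(P(ζ)) = P(ζ)`
    have hxval : ((xC : ↥ℚ⟮ζ⟯) : AlgebraicClosure ℚ) = (x : ↥(κ.layer n)) := rfl
    rcases hcong with h1 | h1
    · have hpow : ζ' ^ ℓ = ζ' := by
        conv_lhs => rw [← Nat.div_add_mod ℓ m, h1, pow_add, pow_mul, hz'.pow_eq_one, one_pow, one_mul, pow_one]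
      rw [hpow]
    · have hpow : ζ' ^ ℓ = ζ' ^ (m - 1) := by
        conv_lhs => rw [← Nat.div_add_mod ℓ m, h1, pow_add, pow_mul, hz'.pow_eq_one, one_pow, one_mul]
      rw [hpow]
      congr 1
      -- `aeval (ζ'^(m-1)) P = aeval ζ' P`: check in `ℚ̄`, where `P(ζ⁻¹) = σ(P(ζ)) = P(ζ)`
      apply Subtype.ext
      apply (algebraMap ↥ℚ⟮ζ⟯ (AlgebraicClosure ℚ)).injective
      change (((aeval (ζ' ^ (m - 1)) P : 𝓞 ↥ℚ⟮ζ⟯) : ↥ℚ⟮ζ⟯) : AlgebraicClosure ℚ) =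
        (((aeval ζ' P : 𝓞 ↥ℚ⟮ζ⟯) : ↥ℚ⟮ζ⟯) : AlgebraicClosure ℚ)
      rw [hcoe, hcoe]
      push_cast
      rw [hζ'val, hζinv, ← hσ,
        show aeval (σ ζ) P = σ (aeval ζ P) from aeval_algHom_apply (σ : AlgebraicClosure ℚ →+* AlgebraicClosure ℚ).toIntAlgHom ζ P]
      have : aeval ζ P = ((xC : ↥ℚ⟮ζ⟯) : AlgebraicClosure ℚ) := by rw [hP, hcoe, hζ'val]
      rw [this, hxval]
      exact hfix x
  -- (⟹): `θ̄^ℓ = θ̄` forces `ℓ ≡ ±1 (mod m)`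
  have hforth : (∀ y : 𝓞 ↥(κ.layer n) ⧸ w, y ^ ℓ = y) → (ℓ % m = 1 ∨ ℓ % m = m - 1) := by
    intro hall
    -- `θ = ζ + ζ⁻¹` as an algebraic integer of `ℚ_n`
    have hθmem : ζ + ζ⁻¹ ∈ κ.layer n := IsCyclotomic.add_inv_mem_layer hκ n hζ
    have hθint : IsIntegral ℤ (⟨ζ + ζ⁻¹, hθmem⟩ : ↥(κ.layer n)) := by
      refine (isIntegral_algebraMap_iff (algebraMap ↥(κ.layer n) (AlgebraicClosure ℚ)).injective).mp ?_
      change IsIntegral ℤ (ζ + ζ⁻¹)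
      exact (hζ.isIntegral hmpos).add (hζ.inv.isIntegral hmpos)
    set θO : 𝓞 ↥(κ.layer n) := ⟨⟨ζ + ζ⁻¹, hθmem⟩, hθint⟩ with hθO
    have hθC : algebraMap (𝓞 ↥(κ.layer n)) (𝓞 ↥ℚ⟮ζ⟯) θO = ζ' + ζ' ^ (m - 1) := by
      apply Subtype.ext
      apply (algebraMap ↥ℚ⟮ζ⟯ (AlgebraicClosure ℚ)).injective
      change ζ + ζ⁻¹ = (((ζ' + ζ' ^ (m - 1) : 𝓞 ↥ℚ⟮ζ⟯) : ↥ℚ⟮ζ⟯) : AlgebraicClosure ℚ)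
      push_cast
      rw [hζ'val, hζinv]
    have hy := hall (Ideal.Quotient.mk w θO)
    have hy' := congrArg (algebraMap (𝓞 ↥(κ.layer n) ⧸ w) (𝓞 ↥ℚ⟮ζ⟯ ⧸ 𝔔)) hy
    rw [map_pow, Ideal.Quotient.algebraMap_mk_of_liesOver, hθC] at hy'
    change (π (ζ' + ζ' ^ (m - 1))) ^ ℓ = π (ζ' + ζ' ^ (m - 1)) at hy'
    -- in the residue field: `a = ζ̄`, `b = ζ̄^ℓ`, `a^(m-1) = a⁻¹`
    set a := π ζ' with ha
    have ha0 : a ≠ 0 := hζbar.ne_zero (by omega)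
    have hainv : a ^ (m - 1) = a⁻¹ := by
      have h1 : a ^ (m - 1) * a = 1 := by rw [← pow_succ, Nat.sub_one_add_one_eq_of_pos hmpos, hζbar.pow_eq_one]
      exact eq_inv_of_mul_eq_one_left h1
    have hb0 : a ^ ℓ ≠ 0 := pow_ne_zero _ ha0
    have hbinv : (a ^ ℓ) ^ (m - 1) = (a ^ ℓ)⁻¹ := by
      rw [← pow_mul, mul_comm, pow_mul, hainv, inv_pow]
    rw [map_add, map_pow, add_pow_char, ← pow_mul, mul_comm (m - 1) ℓ, pow_mul, hbinv, hainv] at hy'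
    rcases eq_or_mul_eq_one_of_add_inv_eq ha0 hb0 hy' with h | h
    · -- `ζ̄^ℓ = ζ̄`: `m ∣ ℓ - 1`
      left
      have h1 : a ^ (ℓ - 1) = 1 := by
        have : a ^ (ℓ - 1) * a = a := by rw [← pow_succ, Nat.sub_one_add_one_eq_of_pos hℓ.pos, h]
        exact mul_right_cancel₀ ha0 (this.trans (one_mul a).symm)
      have hdvd : m ∣ ℓ - 1 := hζbar.dvd_of_pow_eq_one _ h1
      obtain ⟨k, hk⟩ := hdvd
      have hℓ2' := hℓ.two_le
      have : ℓ = m * k + 1 := by omega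
      rw [this, Nat.mul_add_mod]
      exact Nat.mod_eq_of_lt (by omega)
    · -- `ζ̄^{ℓ+1} = 1`: `m ∣ ℓ + 1`
      right
      have h1 : a ^ (ℓ + 1) = 1 := by rw [pow_succ, mul_comm, ← h]
      have hdvd : m ∣ ℓ + 1 := hζbar.dvd_of_pow_eq_one _ h1
      obtain ⟨k, hk⟩ := hdvd
      have hk1 : 1 ≤ k := by
        by_contra h0
        have : k = 0 := by omega
        rw [this, mul_zero] at hk
        omega
      have : ℓ = m * (k - 1) + (m - 1) := by
        have := Nat.sub_one_add_one_eq_of_pos hk1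
        zify [hk1, hmpos] at hk ⊢
        linear_combination hk
      rw [this, Nat.mul_add_mod]
      exact Nat.mod_eq_of_lt (by omega)
  rw [inertiaDeg_eq_one_iff_forall_pow_eq hℓ w, hm]
  exact ⟨hforth, hback⟩

include hκ in
/-- ★ **`g_n(ℓ) = 2ⁿ ⟺ ℓ ≡ ±1 (mod 2^{n+2})`**: an odd prime `ℓ` splits completely in the `n`-th layer `ℚ_n` of the cyclotomic `ℤ₂`-tower
iff `ℓ ≡ ±1 (mod 2^{n+2})` (`g·e·f = 2ⁿ` with `e = 1`). [cite: Washington1997, Thm. 2.13 and Prop. 2.16] -/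
theorem ncard_primesOver_layer_eq_two_pow_iff {ℓ : ℕ} (hℓ : ℓ.Prime) (hℓ2 : ℓ ≠ 2) :
    (haveI : FiniteDimensional ℚ ↥(κ.layer n) := κ.finiteDimensional_layer_holds n
     haveI : NumberField ↥(κ.layer n) := NumberField.of_module_finite ℚ _
     ((Ideal.span {(ℓ : ℤ)}).primesOver (𝓞 ↥(κ.layer n))).ncard = 2 ^ n) ↔
      (ℓ % 2 ^ (n + 2) = 1 ∨ ℓ % 2 ^ (n + 2) = 2 ^ (n + 2) - 1) := by
  haveI : FiniteDimensional ℚ ↥(κ.layer n) := κ.finiteDimensional_layer_holds n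
  haveI : NumberField ↥(κ.layer n) := NumberField.of_module_finite ℚ _
  haveI : IsGalois ℚ ↥(κ.layer n) := κ.isGalois_layer_holds n
  haveI : Fact ℓ.Prime := ⟨hℓ⟩
  haveI : (Ideal.span {(ℓ : ℤ)}).IsMaximal := Int.ideal_span_isMaximal_of_prime ℓ
  have hℓ0 : (Ideal.span {(ℓ : ℤ)}) ≠ ⊥ := by
    rw [Ne, Ideal.span_singleton_eq_bot]; exact_mod_cast hℓ.ne_zero
  obtain ⟨⟨w, hw, hwℓ⟩⟩ := (Ideal.span {(ℓ : ℤ)}).nonempty_primesOver (S := 𝓞 ↥(κ.layer n))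
  haveI := hw
  haveI := hwℓ
  haveI : w.IsMaximal := hw.isMaximal (Ideal.ne_bot_of_liesOver_of_ne_bot hℓ0 w)
  have hfund := Ideal.ncard_primesOver_mul_ramificationIdxIn_mul_inertiaDegIn (Ideal.span {(ℓ : ℤ)}) (𝓞 ↥(κ.layer n))
    (↥(κ.layer n) ≃ₐ[ℚ] ↥(κ.layer n))
  rw [IsGalois.card_aut_eq_finrank, κ.finrank_layer_holds n,
    Ideal.ramificationIdxIn_eq_ramificationIdx (Ideal.span {(ℓ : ℤ)}) w (↥(κ.layer n) ≃ₐ[ℚ] ↥(κ.layer n)),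
    Ideal.inertiaDegIn_eq_inertiaDeg (Ideal.span {(ℓ : ℤ)}) w (↥(κ.layer n) ≃ₐ[ℚ] ↥(κ.layer n)),
    ramificationIdx_eq_one_of_liesOver_layer hκ n hℓ hℓ2 w, one_mul] at hfund
  rw [← inertiaDeg_eq_one_iff_of_liesOver_layer hκ n hℓ hℓ2 w]
  have hfpos : 0 < w.inertiaDeg ℤ := w.inertiaDeg_pos ℤ
  constructor
  · intro hg
    rw [hg] at hfund
    exact Nat.eq_of_mul_eq_mul_left (pow_pos two_pos n) (hfund.trans (mul_one _).symm)
  · intro hf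
    rw [hf, mul_one] at hfund
    exact hfund

end Split

end Literature.NumberTheory.IwasawaTheory

end
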